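import Summits.Ventures.YMGap.Thresholds.CouplingDerivativeSeriesSUN
import HarnessLib

/-!
# Venture YMGap — C-DIFF FOR EVERY `SU(N)`: THE STRONG-COUPLING STATE IS `C¹` IN THE COUPLING WITH THE
# FLUCTUATION–RESPONSE FORMULA `d/db ⟨F⟩_b = N · Σ_q Cov_b(F, W_q)` (`d = 4`; hypothesis-free for `N ≥ 2` at
# 't Hooft `0 < b/N < 9/308`)

HONEST FRAMING: venture file of the cell `pub-ymgap` (QuantumFields programme), seat ds-1; generic-`N` form of
`CouplingDerivative` (`SU(2)`).  Strong-coupling LATTICE statement for `SU(N)` lattice Yang–Mills on `ℤ^4` with the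
Wilson action at tree coupling `b` (weight `exp(−b Σ_p (N − Re tr U_p))`, `W_q = (1/N) Re tr U_q`): differentiability
of the (unique) DLR state in the coupling on cylinder observables and the linear-response identity, inside the
one-sided vertex-star window generated by a one-link modulus `OneLinkKRModulus N R K` (`6 b₁/N ≤ R`,
`4K b₁/N ≤ 9/25`); NOT analyticity; nothing about the continuum, confinement at weak coupling, or the Clay problem.

* `exists_dlrSelection_SU` — a DLR selection exists (compactness).
* ★ `integral_sub_eq_intervalIntegral_SU` — `⟨F⟩_{b'} − ⟨F⟩_{b} = ∫_b^{b'} N·Σ_q Cov_t(F, W_q) dt` on `[0, b₁]`;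
* ★★ `hasDerivAt_integral_star_SU` — `d/db ⟨F⟩_b = N·Σ_q Cov_b(F, W_q)` at every `0 < b < b₁`, along any DLR
  selection (forced by uniqueness), for every Lipschitz cylinder `F`;
* ★★ `hasDerivAt_integral_SU_thooft` — EVERY `N ≥ 2`, HYPOTHESIS-FREE (Bakry–Émery modulus `oneLinkKRModulus_SU`):
  at every tree coupling `0 < b < N·9/308` ('t Hooft `9/308 = 0.0292…`; printed Shen–Zhu–Zhu window `1/48`);
  `hasDerivAt_plaquette_SU_thooft` — the mean plaquette is `C¹` there with derivative `N·Σ_q Cov(W_p, W_q)`.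

References (mechanism only): B. Simon (1993) §II.1, §II.12; R. L. Dobrushin, S. B. Shlosman (1985/87); H. Shen,
R. Zhu, X. Zhu, CMP 400 (2023) Lemma 4.1.
-/

noncomputable section

open MeasureTheory ProbabilityTheory Function Finset Filter Topology Real Set
open scoped NNReal
open Literature.Probability.LatticeModels (Torus.proj Torus.proj_apply HasUniqueGibbsMeasure)
open Literature.MathematicalPhysics.QuantumLattice (LGConfig ZdEdge ZdPlaquette plaquetteEdges torusLift torusEdge
  fundamentalRep continuous_fundamentalRep ymSpecification ymGibbsMeasures)
open Literature.MathematicalPhysics.QuantumFieldTheory hiding ZdEdge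
open Literature.MathematicalPhysics.QuantumFieldTheory.Balaban1983to89.StrongCouplingDobrushinWindow (OneLinkKRModulus)
open Literature.MathematicalPhysics.QuantumFieldTheory.Balaban1983to89.StrongCouplingKernelWindow (oneLinkKRModulus_SU)
open Summit.Ventures.YMGap.DSWindow (starRate starRate_pos)
open Summit.Ventures.YMGap.StarWindowGauge (gaugeR gaugeR_lt_one_of_le)
open Summit.Ventures.YMGap.StarLemmaG (gaugeR_nonneg)
open Summit.Ventures.YMGap.StarLimit (continuous_of_isLipschitzCylinder)
open Summit.Ventures.YMGap.RobustBall (l1 numOrient)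

namespace Summit.Ventures.YMGap.CouplingResponse

variable {N : ℕ}

/-- **A DLR selection exists for `SU(N)`** (a DLR state exists at every coupling by compactness). -/
theorem exists_dlrSelection_SU :
    ∃ μ : ℝ → Measure (LGConfig 4 (Matrix.specialUnitaryGroup (Fin N) ℂ)),
      ∀ b : ℝ, μ b ∈ ymGibbsMeasures (d := 4) (fundamentalRep (Fin N)) b := by
  haveI : SecondCountableTopology (Matrix (Fin N) (Fin N) ℂ) :=
    inferInstanceAs (SecondCountableTopology (Fin N → Fin N → ℂ))
  haveI : SecondCountableTopology (Matrix.specialUnitaryGroup (Fin N) ℂ) :=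
    Topology.IsEmbedding.subtypeVal.secondCountableTopology
  choose μ hμ using fun b : ℝ =>
    ymGibbsMeasures_nonempty (d := 4) (fundamentalRep (Fin N)) (continuous_fundamentalRep (Fin N)) b
  exact ⟨μ, hμ⟩

/-- ★ **THE INTEGRATED FLUCTUATION–RESPONSE FORMULA, `SU(N)`**: under the modulus hypotheses, for any DLR selection
`μ` on `[0, b₁]`, every Lipschitz cylinder `F` and all `b, b' ∈ [0, b₁]`:
`∫_b^{b'} N·(Σ_q Cov_{μ t}(F, W_q)) dt = ⟨F⟩_{μ b'} − ⟨F⟩_{μ b}`. -/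
theorem integral_sub_eq_intervalIntegral_SU (hN : 1 ≤ N) {R K b₁ : ℝ} (hK0 : 0 ≤ K) (hmod : OneLinkKRModulus N R K)
    (hR : b₁ / N * 6 ≤ R) (h925 : 4 * (K * (b₁ / N)) ≤ 9 / 25)
    {μ : ℝ → Measure (LGConfig 4 (Matrix.specialUnitaryGroup (Fin N) ℂ))}
    (hμ : ∀ b ∈ Icc (0 : ℝ) b₁, μ b ∈ ymGibbsMeasures (d := 4) (fundamentalRep (Fin N)) b)
    {F : LGConfig 4 (Matrix.specialUnitaryGroup (Fin N) ℂ) → ℝ} {Λ : Finset (ZdEdge 4)} {KF : ℝ≥0}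
    (hF : IsLipschitzCylinder (fundamentalRep (Fin N)) F Λ KF)
    {x₀ : Literature.Probability.LatticeModels.Site 4} {D : ℕ} (hD : ∀ e ∈ Λ, ‖e.1 - x₀‖ ≤ D)
    {b b' : ℝ} (hb : b ∈ Icc (0 : ℝ) b₁) (hb' : b' ∈ Icc (0 : ℝ) b₁) :
    ∫ t in b..b', (N : ℝ) * ∑' q : ZdPlaquette 4,
        cov[F, zdPlaquetteObs (fundamentalRep (Fin N)) q.1 q.2.1.1 q.2.1.2; μ t] =
      (∫ U, F U ∂(μ b')) - ∫ U, F U ∂(μ b) := by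
  classical
  haveI : SecondCountableTopology (Matrix (Fin N) (Fin N) ℂ) :=
    inferInstanceAs (SecondCountableTopology (Fin N → Fin N → ℂ))
  haveI : SecondCountableTopology (Matrix.specialUnitaryGroup (Fin N) ℂ) :=
    Topology.IsEmbedding.subtypeVal.secondCountableTopology
  have hN0 : (0 : ℝ) < N := by exact_mod_cast (show 0 < N by omega)
  have hβ₁0 : 0 ≤ b₁ := hb.1.trans hb.2
  have hb₁N : 0 ≤ b₁ / N := div_nonneg hβ₁0 hN0.le
  obtain ⟨hρ0, hρ1⟩ := gaugeR_coef_lt_one (N := N) (R := R) hK0 hb₁N h925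
  have hFc : Continuous F := continuous_of_isLipschitzCylinder hF
  have hFb : ∀ U, |F U| ≤ |F 1| + 2 * KF := fun U => hF.abs_le U
  set L₀ : ℕ := 4 * D + 4 with hL₀
  have hlift := fun n : ℕ => exists_centredLift (n + 1) x₀ (d := 4)
  choose s hs hcen hfix using hlift
  set φ : ℕ → ℝ → ℝ := fun n t =>
    ∫ U, F U ∂(torusState (d := 4) (fundamentalRep (Fin N)) t (n + L₀ + 1)) with hφ
  set Dn : ℕ → ℝ → ℝ := fun n t => ∑ y : Site 4 (n + L₀ + 1), ∑ p : {p : Fin 4 × Fin 4 // p.1 < p.2},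
    (N : ℝ) * cov[F, zdPlaquetteObs (fundamentalRep (Fin N)) (s (n + L₀) y) p.1.1 p.1.2;
      torusState (d := 4) (fundamentalRep (Fin N)) t (n + L₀ + 1)] with hDn
  set B : ℝ := N * (numOrient 4 * (4 * (2 * Real.sqrt N) ^ 2 * Real.exp (starRate (gaugeR (4 * (K * (b₁ / N)))) * (D + 3)) *
    ((Λ.card : ℝ) * KF) * (16 * (N : ℝ) ^ 3) *
    ((1 + Real.exp (-(starRate (gaugeR (4 * (K * (b₁ / N)))) / 4))) /
      (1 - Real.exp (-(starRate (gaugeR (4 * (K * (b₁ / N)))) / 4)))) ^ 4)) with hB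
  have hderiv : ∀ n, ∀ t ∈ Icc (0 : ℝ) b₁, HasDerivAt (φ n) (Dn n t) t := fun n t _ =>
    hasDerivAt_integral_torusState_SU (d := 4) (N := N) (L := n + L₀ + 1) hF.measurable hFb (hs (n + L₀)) t
  have hbound : ∀ n, ∀ t ∈ Icc (0 : ℝ) b₁, |Dn n t| ≤ B := by
    intro n t ht
    exact abs_responseSum_torusState_le_SU (L := n + L₀ + 1) t hρ0 hρ1
      (star_window_uniform (by omega) hN hK0 hmod hR h925 ht.1 ht.2) hF hD (by omega) (hs (n + L₀)) (hcen (n + L₀))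
  have hφlim : ∀ t ∈ Icc (0 : ℝ) b₁, Tendsto (fun n => φ n t) atTop (𝓝 (∫ U, F U ∂(μ t))) := by
    intro t ht
    have hu := hasUniqueGibbsMeasure_of_modulus hN hK0 hmod hR h925 ht.1 ht.2
    have h := tendsto_integral_torusState_of_subsingleton (d := 4) (fundamentalRep (Fin N))
      (continuous_fundamentalRep (Fin N)) hu.1 (hμ t ht) hFc hFb
    exact h.comp (tendsto_add_atTop_nat L₀)
  have hDlim : ∀ t ∈ Icc (0 : ℝ) b₁, Tendsto (fun n => Dn n t) atTop
      (𝓝 ((N : ℝ) * ∑' q : ZdPlaquette 4, cov[F, zdPlaquetteObs (fundamentalRep (Fin N)) q.1 q.2.1.1 q.2.1.2; μ t])) := by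
    intro t ht
    have h := ((tendsto_responseSum_SU hN hK0 hmod hR h925 ht.1 ht.2 (hμ t ht) hF hD s hs hcen hfix).const_mul
      (N : ℝ)).comp (tendsto_add_atTop_nat L₀)
    refine h.congr fun n => ?_
    simp only [Function.comp_apply, hDn, Finset.mul_sum]
  exact intervalIntegral_eq_sub_of_tendsto hderiv hbound hφlim hDlim hb hb'

/-- ★★ **THE FLUCTUATION–RESPONSE FORMULA / `C¹` IN THE COUPLING, `SU(N)`**: under the modulus hypotheses, for any
DLR selection `μ` on `[0, b₁]` (forced by uniqueness), every Lipschitz cylinder `F`, and every `0 < b < b₁`: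
`d/db ⟨F⟩_{μ b} = N · Σ_q Cov_{μ b}(F, W_q)`, the series converging absolutely and the derivative being continuous on
`[0, b₁]`. -/
theorem hasDerivAt_integral_star_SU (hN : 1 ≤ N) {R K b₁ : ℝ} (hK0 : 0 ≤ K) (hmod : OneLinkKRModulus N R K)
    (hR : b₁ / N * 6 ≤ R) (h925 : 4 * (K * (b₁ / N)) ≤ 9 / 25)
    {μ : ℝ → Measure (LGConfig 4 (Matrix.specialUnitaryGroup (Fin N) ℂ))}
    (hμ : ∀ b ∈ Icc (0 : ℝ) b₁, μ b ∈ ymGibbsMeasures (d := 4) (fundamentalRep (Fin N)) b)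
    {F : LGConfig 4 (Matrix.specialUnitaryGroup (Fin N) ℂ) → ℝ} {Λ : Finset (ZdEdge 4)} {KF : ℝ≥0}
    (hF : IsLipschitzCylinder (fundamentalRep (Fin N)) F Λ KF)
    {x₀ : Literature.Probability.LatticeModels.Site 4} {D : ℕ} (hD : ∀ e ∈ Λ, ‖e.1 - x₀‖ ≤ D)
    {b : ℝ} (hb : b ∈ Ioo (0 : ℝ) b₁) :
    HasDerivAt (fun t => ∫ U, F U ∂(μ t))
      ((N : ℝ) * ∑' q : ZdPlaquette 4, cov[F, zdPlaquetteObs (fundamentalRep (Fin N)) q.1 q.2.1.1 q.2.1.2; μ b]) b := by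
  have hβ₁0 : 0 ≤ b₁ := hb.1.le.trans hb.2.le
  refine hasDerivAt_of_intervalIntegral_eq (a := 0) (c := b₁)
    (g := fun t => (N : ℝ) * ∑' q : ZdPlaquette 4, cov[F, zdPlaquetteObs (fundamentalRep (Fin N)) q.1 q.2.1.1 q.2.1.2; μ t])
    (fun t ht => ?_) (continuousOn_const.mul (continuousOn_responseSum_SU hN hK0 hmod hR h925 hμ hF hD)) hb
  exact integral_sub_eq_intervalIntegral_SU hN hK0 hmod hR h925 hμ hF hD (left_mem_Icc.2 hβ₁0) ht

/-- ★★ **EVERY `SU(N)`, `N ≥ 2`, HYPOTHESIS-FREE** (Bakry–Émery modulus `oneLinkKRModulus_SU`, `b₁ = N·9/308`): for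
any DLR selection `μ` on `[0, N·9/308]`, every Lipschitz cylinder `F` and every tree coupling `0 < b < N·9/308`
('t Hooft `b/N < 9/308`): `d/db ⟨F⟩_{μ b} = N · Σ_q Cov_{μ b}(F, W_q)`. [folklore] -/
theorem hasDerivAt_integral_SU_thooft (hN : 2 ≤ N)
    {μ : ℝ → Measure (LGConfig 4 (Matrix.specialUnitaryGroup (Fin N) ℂ))}
    (hμ : ∀ b ∈ Icc (0 : ℝ) ((N : ℝ) * (9 / 308)), μ b ∈ ymGibbsMeasures (d := 4) (fundamentalRep (Fin N)) b)
    {F : LGConfig 4 (Matrix.specialUnitaryGroup (Fin N) ℂ) → ℝ} {Λ : Finset (ZdEdge 4)} {KF : ℝ≥0}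
    (hF : IsLipschitzCylinder (fundamentalRep (Fin N)) F Λ KF)
    {x₀ : Literature.Probability.LatticeModels.Site 4} {D : ℕ} (hD : ∀ e ∈ Λ, ‖e.1 - x₀‖ ≤ D)
    {b : ℝ} (hb : b ∈ Ioo (0 : ℝ) ((N : ℝ) * (9 / 308))) :
    HasDerivAt (fun t => ∫ U, F U ∂(μ t))
      ((N : ℝ) * ∑' q : ZdPlaquette 4, cov[F, zdPlaquetteObs (fundamentalRep (Fin N)) q.1 q.2.1.1 q.2.1.2; μ b]) b := by
  have hN0 : (0 : ℝ) < N := by exact_mod_cast (show 0 < N by omega)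
  set b₁ : ℝ := (N : ℝ) * (9 / 308) with hb₁
  have hb₁N : b₁ / N = 9 / 308 := by rw [hb₁]; field_simp
  have hb₁0 : 0 ≤ b₁ := by positivity
  obtain ⟨h1, hK0, h4⟩ := StarSUN.bakryEmery_coef_le (by omega) hb₁0 hb₁N.le
  have hab : |b₁| / N = b₁ / N := by rw [abs_of_nonneg hb₁0]
  rw [hab] at h1 hK0 h4
  exact hasDerivAt_integral_star_SU (by omega) hK0 (oneLinkKRModulus_SU hN h1) le_rfl h4 hμ hF hD hb

/-- ★ **The `SU(N)` mean plaquette is `C¹` on `(0, N·9/308)`** with derivative `N·Σ_q Cov_b(W_p, W_q)`, every `N ≥ 2`,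
hypothesis-free — no first- or second-order transition of the lattice internal energy inside the window. -/
theorem hasDerivAt_plaquette_SU_thooft (hN : 2 ≤ N)
    {μ : ℝ → Measure (LGConfig 4 (Matrix.specialUnitaryGroup (Fin N) ℂ))}
    (hμ : ∀ b ∈ Icc (0 : ℝ) ((N : ℝ) * (9 / 308)), μ b ∈ ymGibbsMeasures (d := 4) (fundamentalRep (Fin N)) b)
    (p : ZdPlaquette 4) {b : ℝ} (hb : b ∈ Ioo (0 : ℝ) ((N : ℝ) * (9 / 308))) :
    HasDerivAt (fun t => ∫ U, zdPlaquetteObs (fundamentalRep (Fin N)) p.1 p.2.1.1 p.2.1.2 U ∂(μ t))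
      ((N : ℝ) * ∑' q : ZdPlaquette 4, cov[zdPlaquetteObs (fundamentalRep (Fin N)) p.1 p.2.1.1 p.2.1.2,
        zdPlaquetteObs (fundamentalRep (Fin N)) q.1 q.2.1.1 q.2.1.2; μ b]) b :=
  hasDerivAt_integral_SU_thooft hN hμ (isLipschitzCylinder_zdPlaquetteObs (N := N) p.1 p.2.2) (x₀ := p.1) (D := 1)
    (fun e he => by simpa using norm_fst_sub_le_of_mem_plaquetteEdges he) hb

end Summit.Ventures.YMGap.CouplingResponse

end
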